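import Summits.QuantumFields.YangMills.Theorems.BalabanUVNodesN08HaarCompatibilityGuardHybridNearBlocks
import Summits.QuantumFields.YangMills.Theorems.BalabanUVNodesN08HaarCompatibilityGuardHybridCovariance
import Summits.QuantumFields.YangMills.Theorems.BalabanUVNodesN08HaarCompatibilityForests

/-!
# BalabanUVNodes ∕ N08 — FOREST POLYMERS ARE INVISIBLE AT THE NEXT LEVEL: if the near set of a finset `S` of guarded coarse bonds (the bonds with both end blocks among the
# end blocks of `S`) is ACYCLIC, then for every gauge-invariant density `ρ ≥ 0` reading only those blocks the transported guarded part `((ρ·1_{G_S})·dU)∘(Ū^S)⁻¹` is EXACTLY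
# `(∫ ρ·1_{G_S} dU) • dV`; the shape of the floored Haar iterate after one step is carried only by polymers whose near set contains a CYCLE (a coarse plaquette)

WIDTH SEAT `pub-ymgap-dag-n08-w3` g7, item-3 lineage PART 39 (successor of parts 35 `…GuardHybridFresh` (product form), 37 `…GuardHybridNearBlocks` (canonical far set), 38A
`…GuardHybridCovariance` (gauge covariance of `Ū^S`) and of the g0 part 4 `…HaarCompatibilityForests` (forests are product Haar under every gauge-invariant law)), 2026-08-28.  Track A,
DAG node N08 = [Balaban1985UV3] Thm 1 p. 257 (compact) + Thm 2 p. 272; key item K1⁷ `StabilityBAtRecordR13SepCoPH` (stmt-QuantumFields-20542), `--supports … --as helper`.  COUNT-NEUTRAL.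

THE POINT (located; road (ii) bookkeeping, n08-w1 g6 `N08-NO-STACKING-MECHANISM.md` §3∕§5; count-neutral).  Part 38B showed that singleton polymers leave no trace.  The mechanism is
general: under `(ρ·1_{G_S})·dU` with `ρ` gauge invariant, the image law along `Ū^S` is coarse-gauge invariant (part 38A), its far coordinates (an end block outside `Blk(S)`) are fresh Haar
and independent of the near ones (parts 35∕37), and the near coordinates — the bonds with BOTH end blocks in `Blk(S)` — are product Haar WHENEVER THEY FORM A FOREST (g0 part 4: a gauge
invariant law is product Haar on every acyclic family).  Hence (§2 `map_withDensity_guard_hybrid_eq_smul_of_forest`):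
  **`((ρ·1_{G_S})·dU)∘(Ū^S)⁻¹ = (∫ ρ·1_{G_S} dU) • dV`   whenever the near set of `S` admits a leaf-extension order.**
READING: collinear pairs, L-shaped pairs, stars, paths … of guarded bonds are ALL invisible after one step; the first polymers that can shape the transported density are those whose
end blocks contain the four corners of a coarse PLAQUETTE (e.g. two parallel guarded bonds one lattice step apart: activity `≤ q²`, and the bump is a function of the plaquette's
bonds — a gauge-invariant one, i.e. of its holonomy).  This is the precise sense in which «the E6′ ∕ no-stacking defect lives in cycle holonomies» (g0 part 4's header) propagates
to the polymer bookkeeping.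

* §1 `piCongrLeft_symm_apply'` (reindexing, plumbing), `map_evalFamily_eq_mass_smul_pi_haar_of_leafOrder` (g0 part 4 for FINITE gauge-invariant laws: mass factored out).
* §2 ★★★ `map_withDensity_guard_hybrid_eq_smul_of_forest`; ★★ `map_restrict_guard_hybrid_eq_smul_of_forest` (`ρ ≡ 1`: `(dU↾G_S)∘(Ū^S)⁻¹ = dU(G_S) • dV`).
* §3 the same at the [B10] slot's averaging `avOfPrint N S₀ j` on `SU(N)`, every `N`, standing range.

HONEST FRAMING.  [folklore] measure theory over landed modules; nothing of Bałaban's asserted; an EXACT identity for acyclic polymers only — no bound for polymers with cycles, NO cluster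
expansion ∕ (G3), NO k-uniform `hmass`; E6′ NOT decided; N08 NOT discharged; counts unmoved (typed 28∕28 · discharged 5∕27); one finite 𝕋⁴ programme at fixed ε — R4 closes the CONDITIONAL
rung `BalabanLadder.UV` only; the Yang–Mills mass gap (Clay) is NOT proved by any of this; nothing continuum ∕ ℝ⁴ ∕ OS.  0 `sorry`, 0 `def`, 0 `instance`, standard axioms.
-/

noncomputable section

open MeasureTheory
open scoped ENNReal

namespace Summit.QuantumFields.YangMills.BalabanUVNodes.N08HaarCompatibilityGuardHybridForestPolymer

open Literature.MathematicalPhysics.QuantumFieldTheory.Balaban1983to89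
open Literature.MathematicalPhysics.QuantumFieldTheory.Balaban1983to89.AveragingRT (axialAvg measurable_axialAvg line)
open Literature.MathematicalPhysics.QuantumFieldTheory.Balaban1983to89.BlockAveraging (Small avgFun measurable_avgFun)
open Literature.MathematicalPhysics.QuantumFieldTheory.Balaban1983to89.B12RTGaugeInvariance254 (measurable_gaugeAct)
open Summit.QuantumFields.Balaban3D.Proofs
open Summit.QuantumFields.YangMills.BalabanUVNodes.N08AxialDecimationForgetsSelected (piCongrLeft_const_apply)
open Summit.QuantumFields.YangMills.BalabanUVNodes.N08HaarCompatibilityPrivateSources (measurable_evalFamily)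
open Summit.QuantumFields.YangMills.BalabanUVNodes.N08HaarCompatibilityForests (map_evalFamily_eq_pi_haar_of_leafOrder)
open Summit.QuantumFields.YangMills.BalabanUVNodes.N08HaarCompatibilityGuardHybridPartition (measurable_hybrid measurableSet_guardAll)
open Summit.QuantumFields.YangMills.BalabanUVNodes.N08HaarCompatibilityGuardHybridFresh (map_withDensity_hybrid_split_eq_prod splitEquiv_fst_apply)
open Summit.QuantumFields.YangMills.BalabanUVNodes.N08HaarCompatibilityGuardHybridNearBlocks
  (canonical_tau_lt canonical_far_spec not_canonicalFar_iff localOff_of_blockLocal blockLocal_mul_guardAll_indicator)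
open Summit.QuantumFields.YangMills.BalabanUVNodes.N08HaarCompatibilityGuardHybridCovariance
  (map_gaugeAct_withDensity_of_gaugeInvariant gaugeInvariant_mul_guardAll_indicator map_gaugeAct_map_hybrid)

/-! ## §1 Plumbing: reindexing along an enumeration; forests under FINITE gauge-invariant laws -/

section Plumbing

variable {ι ι' : Type*} {G : Type*} [MeasurableSpace G]

/-- The inverse reindexing: `(piCongrLeft (fun _ => G) f).symm w = w ∘ f` (plumbing). [folklore] -/
theorem piCongrLeft_symm_apply' (f : ι' ≃ ι) (w : ι → G) : (MeasurableEquiv.piCongrLeft (fun _ : ι => G) f).symm w = fun i' => w (f i') := by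
  apply (MeasurableEquiv.piCongrLeft (fun _ : ι => G) f).injective
  rw [MeasurableEquiv.apply_symm_apply]
  funext i
  rw [piCongrLeft_const_apply, Equiv.apply_symm_apply]

end Plumbing

section Forest

variable {P : Params} {k : ℕ} {G : Type*} [GaugeGroup G] [MeasurableSpace G] [HaarData G] [RegularGaugeGroup G]

/-- **FORESTS ARE `mass • Haar^n` UNDER EVERY FINITE GAUGE-INVARIANT LAW** (g0 part 4's probability statement with the mass factored out; the zero law apart).
[cite: Balaban1987RG1, (2.1) p.265 (bookkeeping); folklore] -/
theorem map_evalFamily_eq_mass_smul_pi_haar_of_leafOrder {n : ℕ} (b : Fin n → PBond P k) (side : Fin n → Bool)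
    (hleaf : ∀ m m' : Fin n, m' < m →
      (if side m then (b m).src else (b m).tgt) ≠ (b m').src ∧ (if side m then (b m).src else (b m).tgt) ≠ (b m').tgt)
    (ν : Measure (GaugeField P k G)) (hfin : IsFiniteMeasure ν) (hν : ∀ v : GaugeTransf P k G, ν.map (GaugeField.gaugeAct v) = ν) :
    ν.map (fun (V : GaugeField P k G) (m : Fin n) => V (b m)) = ν Set.univ • Measure.pi fun _ : Fin n => (HaarData.haar : Measure G) := by
  haveI := HaarData.isProb (G := G)
  haveI := hfin
  by_cases h0 : ν Set.univ = 0
  · have hν0 : ν = 0 := Measure.measure_univ_eq_zero.1 h0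
    rw [h0, zero_smul, hν0, Measure.map_zero]
  · have htop : ν Set.univ ≠ ∞ := measure_ne_top _ _
    set ν' : Measure (GaugeField P k G) := (ν Set.univ)⁻¹ • ν with hν'
    haveI : IsProbabilityMeasure ν' := ⟨by rw [hν', Measure.smul_apply, smul_eq_mul, ENNReal.inv_mul_cancel h0 htop]⟩
    have hν'inv : ∀ v : GaugeTransf P k G, ν'.map (GaugeField.gaugeAct v) = ν' := fun v => by
      rw [hν', Measure.map_smul, hν v]
    have h := map_evalFamily_eq_pi_haar_of_leafOrder b side hleaf ν' hν'inv
    have hνeq : ν = ν Set.univ • ν' := by rw [hν', smul_smul, ENNReal.mul_inv_cancel h0 htop, one_smul]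
    conv_lhs => rw [hνeq]
    rw [Measure.map_smul, h]

end Forest

/-! ## §2 Forest polymers are transported to a constant multiple of `dV` -/

section ForestPolymer

variable {P : Params} {j : ℕ} {G : Type} [GaugeGroup G] (ℰ : LoopAverage G) [DecidableEq (PBond P (j + 1))] [MeasurableSpace G] [RegularGaugeGroup G] [HaarData G]

/-- ★★★ **FOREST POLYMERS ARE INVISIBLE AT THE NEXT LEVEL.**  Standing range, every measurable small-loop average `ℰ`, every finset `S` of coarse bonds whose NEAR SET — the bonds
with both end blocks among `Blk(S) = {c.src, c.tgt : c ∈ S}` — is enumerated by an injective `b : Fin n → PBond` admitting a leaf-extension order (`side`, `hleaf`: an acyclic family),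
and every gauge-invariant, non-negative, measurable, integrable density `ρ` reading only the bonds issuing from `Blk(S)`:
**`((ρ·1_{G_S})·dU)∘(Ū^S)⁻¹ = (∫ ρ·1_{G_S} dU) • dV`** — the transported guarded part of an acyclic polymer has CONSTANT density.  Mechanism: coarse-gauge invariance of the image
(part 38A) makes the near marginal a gauge-invariant finite law on a forest, hence `mass • Haar^{near}` (g0 part 4, §1); the far marginal is `Haar^{far}` and independent (parts 35∕37).
[cite: Balaban1987RG1, (2.1) p.265 + (0.4) p.253; Balaban1985UV3, (10) p.258 + (48)–(49) p.268; Balaban1985Averaging, (11)+(15) p.19 (bookkeeping — the identity is NOT in print)] -/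
theorem map_withDensity_guard_hybrid_eq_smul_of_forest (hj : j + 1 ≤ P.m + P.K) (hE : ∀ n, Measurable fun W : Fin (n + 1) → G => ℰ.E W) (S : Finset (PBond P (j + 1)))
    {n : ℕ} (b : Fin n → PBond P (j + 1)) (hbinj : Function.Injective b)
    (hbnear : ∀ m, (b m).src ∈ S.image PBond.src ∪ S.image PBond.tgt ∧ (b m).tgt ∈ S.image PBond.src ∪ S.image PBond.tgt)
    (hbonto : ∀ c' : PBond P (j + 1), c'.src ∈ S.image PBond.src ∪ S.image PBond.tgt ∧ c'.tgt ∈ S.image PBond.src ∪ S.image PBond.tgt → ∃ m, b m = c')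
    (side : Fin n → Bool)
    (hleaf : ∀ m m' : Fin n, m' < m →
      (if side m then (b m).src else (b m).tgt) ≠ (b m').src ∧ (if side m then (b m).src else (b m).tgt) ≠ (b m').tgt)
    (ρ : Density P j G) (hρm : Measurable ρ) (hρ0 : ∀ W, 0 ≤ ρ W) (hρ : Integrable ρ (fieldMeasure P j G)) (hρinv : GaugeField.GaugeInvariant ρ)
    (hloc : ∀ W W' : GaugeField P j G, (∀ b' : PBond P j, blockOf b'.src ∈ S.image PBond.src ∪ S.image PBond.tgt → W b' = W' b') → ρ W = ρ W') :
    ((fieldMeasure P j G).withDensity fun U => ENNReal.ofReal (ρ U * {W : GaugeField P j G | ∀ c ∈ S, Small ℰ W c}.indicator (fun _ => (1 : ℝ)) U)).map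
        (fun U => (fun c => if c ∈ S then avgFun ℰ U c else axialAvg U c : GaugeField P (j + 1) G)) =
      ENNReal.ofReal (∫ U, ρ U * {W : GaugeField P j G | ∀ c ∈ S, Small ℰ W c}.indicator (fun _ => (1 : ℝ)) U ∂(fieldMeasure P j G)) • fieldMeasure P (j + 1) G := by
  haveI := HaarData.isProb (G := G)
  -- the guarded density `ρ' = ρ·1_{G_S}`
  have hρ'm : Measurable fun U : GaugeField P j G => ρ U * {W : GaugeField P j G | ∀ c ∈ S, Small ℰ W c}.indicator (fun _ => (1 : ℝ)) U :=
    hρm.mul (measurable_const.indicator (measurableSet_guardAll ℰ _))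
  have hρ'0 : ∀ W : GaugeField P j G, 0 ≤ ρ W * {W : GaugeField P j G | ∀ c ∈ S, Small ℰ W c}.indicator (fun _ => (1 : ℝ)) W :=
    fun W => mul_nonneg (hρ0 W) (Set.indicator_nonneg (fun _ _ => zero_le_one) W)
  have hρ' : Integrable (fun U : GaugeField P j G => ρ U * {W : GaugeField P j G | ∀ c ∈ S, Small ℰ W c}.indicator (fun _ => (1 : ℝ)) U) (fieldMeasure P j G) :=
    hρ.mul_bdd ((measurable_const.indicator (measurableSet_guardAll ℰ _)).aestronglyMeasurable) (c := 1)
      (Filter.Eventually.of_forall fun U => by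
        by_cases hU : U ∈ {W : GaugeField P j G | ∀ c ∈ S, Small ℰ W c}
        · rw [Set.indicator_of_mem hU]; simp
        · rw [Set.indicator_of_notMem hU]; simp)
  have hρ'inv := gaugeInvariant_mul_guardAll_indicator ℰ S hρinv
  have hρ'loc := blockLocal_mul_guardAll_indicator ℰ hj S ρ hloc
  set ρ' : GaugeField P j G → ℝ := fun U => ρ U * {W : GaugeField P j G | ∀ c ∈ S, Small ℰ W c}.indicator (fun _ => (1 : ℝ)) U with hρ'def
  set μρ : Measure (GaugeField P j G) := (fieldMeasure P j G).withDensity fun U => ENNReal.ofReal (ρ' U) with hμρ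
  haveI hfin : IsFiniteMeasure μρ := by
    refine ⟨?_⟩
    rw [hμρ, withDensity_apply _ MeasurableSet.univ, Measure.restrict_univ]
    exact (lintegral_ofReal_le_lintegral_enorm ρ').trans_lt hρ'.2
  have hμinv : ∀ u : GaugeTransf P j G, μρ.map (GaugeField.gaugeAct u) = μρ := fun u => map_gaugeAct_withDensity_of_gaugeInvariant hρ'm hρ'inv u
  have hHm : Measurable fun U : GaugeField P j G => (fun c => if c ∈ S then avgFun ℰ U c else axialAvg U c : GaugeField P (j + 1) G) := measurable_hybrid ℰ hE S
  -- the image law `ν` and its coarse-gauge invariance (part 38A)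
  set ν : Measure (GaugeField P (j + 1) G) := μρ.map fun U : GaugeField P j G => (fun c => if c ∈ S then avgFun ℰ U c else axialAvg U c : GaugeField P (j + 1) G) with hν
  have hνinv : ∀ v : GaugeTransf P (j + 1) G, ν.map (GaugeField.gaugeAct v) = ν := fun v => map_gaugeAct_map_hybrid ℰ hj hE S μρ hμinv v
  have hνfin : IsFiniteMeasure ν := Measure.isFiniteMeasure_map μρ _
  have hνmass : ν Set.univ = μρ Set.univ := by
    rw [hν]
    exact (Measure.map_apply hHm MeasurableSet.univ).trans (by rw [Set.preimage_univ])
  -- g0 part 4 on the image law: the near family `b` is `mass • Haar^n`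
  have hforest := map_evalFamily_eq_mass_smul_pi_haar_of_leafOrder b side hleaf ν hνfin hνinv
  rw [hνmass] at hforest
  have hforest' : μρ.map (fun (U : GaugeField P j G) (m : Fin n) => (if b m ∈ S then avgFun ℰ U (b m) else axialAvg U (b m))) =
      μρ Set.univ • Measure.pi (fun _ : Fin n => (HaarData.haar : Measure G)) :=
    (Measure.map_map (measurable_evalFamily b) hHm).symm.trans hforest
  -- the canonical far set of `S`, its selected-bond instance, and part 35's product form
  haveI : DecidablePred fun b' : PBond P j => ∃ c' : PBond P (j + 1),
      (c'.src ∉ S.image PBond.src ∪ S.image PBond.tgt ∨ c'.tgt ∉ S.image PBond.src ∪ S.image PBond.tgt) ∧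
        line c' (if c'.src ∉ S.image PBond.src ∪ S.image PBond.tgt then 0 else P.L - 1) = b' := Classical.decPred _
  have hprod := map_withDensity_hybrid_split_eq_prod ℰ hj hE S
    (fun c' : PBond P (j + 1) => c'.src ∉ S.image PBond.src ∪ S.image PBond.tgt ∨ c'.tgt ∉ S.image PBond.src ∪ S.image PBond.tgt)
    (fun c' : PBond P (j + 1) => if c'.src ∉ S.image PBond.src ∪ S.image PBond.tgt then 0 else P.L - 1)
    (fun c' _ => canonical_tau_lt _ c') (canonical_far_spec hj _) ρ' hρ'0 hρ' (localOff_of_blockLocal hj _ ρ' hρ'loc)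
  -- the enumeration of the near index type by `b`
  have hbmem : ∀ m, ¬ ((b m).src ∉ S.image PBond.src ∪ S.image PBond.tgt ∨ (b m).tgt ∉ S.image PBond.src ∪ S.image PBond.tgt) :=
    fun m => (not_canonicalFar_iff _ (b m)).2 (hbnear m)
  let e : Fin n ≃ {c' : PBond P (j + 1) // ¬ (c'.src ∉ S.image PBond.src ∪ S.image PBond.tgt ∨ c'.tgt ∉ S.image PBond.src ∪ S.image PBond.tgt)} :=
    Equiv.ofBijective (fun m => ⟨b m, hbmem m⟩)
      ⟨fun m m' h => hbinj (congrArg Subtype.val h), fun x => by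
        obtain ⟨m, hm⟩ := hbonto x.1 ((not_canonicalFar_iff _ x.1).1 x.2)
        exact ⟨m, Subtype.ext hm⟩⟩
  have he : ∀ m, (e m).1 = b m := fun m => rfl
  -- the reindexing `R : (near → G) ≃ᵐ (Fin n → G)`, `R w = w ∘ e`, pushes `Haar^{near}` to `Haar^{Fin n}`
  set R := (MeasurableEquiv.piCongrLeft (fun _ : {c' : PBond P (j + 1) //
      ¬ (c'.src ∉ S.image PBond.src ∪ S.image PBond.tgt ∨ c'.tgt ∉ S.image PBond.src ∪ S.image PBond.tgt)} => G) e).symm with hRdef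
  have hR_apply : ∀ w, R w = fun m => w (e m) := fun w => piCongrLeft_symm_apply' e w
  have hRmp : MeasurePreserving R (Measure.pi fun _ => (HaarData.haar : Measure G)) (Measure.pi fun _ : Fin n => (HaarData.haar : Measure G)) :=
    (MeasureTheory.measurePreserving_piCongrLeft (fun _ : {c' : PBond P (j + 1) //
      ¬ (c'.src ∉ S.image PBond.src ∪ S.image PBond.tgt ∨ c'.tgt ∉ S.image PBond.src ∪ S.image PBond.tgt)} => (HaarData.haar : Measure G)) e).symm _
  -- the near marginal is `m • Haar^{near}`
  have hΦ1m : Measurable fun U : GaugeField P j G => (FibreSplit.splitEquiv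
      (fun c' : PBond P (j + 1) => c'.src ∉ S.image PBond.src ∪ S.image PBond.tgt ∨ c'.tgt ∉ S.image PBond.src ∪ S.image PBond.tgt) (P := P) (G := G)
      (fun c => if c ∈ S then avgFun ℰ U c else axialAvg U c)).1 :=
    measurable_fst.comp ((FibreSplit.splitEquiv _ (P := P) (G := G)).measurable.comp hHm)
  have hnear : μρ.map (fun U : GaugeField P j G => (FibreSplit.splitEquiv
      (fun c' : PBond P (j + 1) => c'.src ∉ S.image PBond.src ∪ S.image PBond.tgt ∨ c'.tgt ∉ S.image PBond.src ∪ S.image PBond.tgt) (P := P) (G := G)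
      (fun c => if c ∈ S then avgFun ℰ U c else axialAvg U c)).1) =
      μρ Set.univ • Measure.pi (fun _ => (HaarData.haar : Measure G)) := by
    have h1 : (μρ.map (fun U : GaugeField P j G => (FibreSplit.splitEquiv
        (fun c' : PBond P (j + 1) => c'.src ∉ S.image PBond.src ∪ S.image PBond.tgt ∨ c'.tgt ∉ S.image PBond.src ∪ S.image PBond.tgt) (P := P) (G := G)
        (fun c => if c ∈ S then avgFun ℰ U c else axialAvg U c)).1)).map R =
        μρ.map (fun (U : GaugeField P j G) (m : Fin n) => (if b m ∈ S then avgFun ℰ U (b m) else axialAvg U (b m))) := by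
      rw [Measure.map_map R.measurable hΦ1m]
      refine Measure.map_congr (Filter.Eventually.of_forall fun U => ?_)
      show R _ = _
      rw [hR_apply]
      rfl
    have h2 : (μρ Set.univ • Measure.pi (fun _ : {c' : PBond P (j + 1) //
        ¬ (c'.src ∉ S.image PBond.src ∪ S.image PBond.tgt ∨ c'.tgt ∉ S.image PBond.src ∪ S.image PBond.tgt)} => (HaarData.haar : Measure G))).map R =
        μρ Set.univ • Measure.pi (fun _ : Fin n => (HaarData.haar : Measure G)) := by
      rw [Measure.map_smul, hRmp.map_eq]
    calc μρ.map _ = ((μρ.map _).map R).map R.symm := (MeasurableEquiv.map_symm_map R).symm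
      _ = (μρ.map (fun (U : GaugeField P j G) (m : Fin n) => (if b m ∈ S then avgFun ℰ U (b m) else axialAvg U (b m)))).map R.symm := by rw [h1]
      _ = (μρ Set.univ • Measure.pi (fun _ : Fin n => (HaarData.haar : Measure G))).map R.symm := by rw [hforest']
      _ = ((μρ Set.univ • Measure.pi (fun _ : {c' : PBond P (j + 1) //
          ¬ (c'.src ∉ S.image PBond.src ∪ S.image PBond.tgt ∨ c'.tgt ∉ S.image PBond.src ∪ S.image PBond.tgt)} => (HaarData.haar : Measure G))).map R).map R.symm := by
            rw [h2]
      _ = _ := MeasurableEquiv.map_symm_map R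
  -- assemble exactly as in part 38B
  have hsplit := (FibreSplit.measurePreserving_split
    (fun c' : PBond P (j + 1) => c'.src ∉ S.image PBond.src ∪ S.image PBond.tgt ∨ c'.tgt ∉ S.image PBond.src ∪ S.image PBond.tgt) (P := P) (j := j + 1) (G := G)).map_eq
  have himage : (μρ.map (fun U : GaugeField P j G => (fun c => if c ∈ S then avgFun ℰ U c else axialAvg U c : GaugeField P (j + 1) G))).map
        (FibreSplit.splitEquiv
          (fun c' : PBond P (j + 1) => c'.src ∉ S.image PBond.src ∪ S.image PBond.tgt ∨ c'.tgt ∉ S.image PBond.src ∪ S.image PBond.tgt) (P := P) (G := G)) =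
      (μρ Set.univ • fieldMeasure P (j + 1) G).map
        (FibreSplit.splitEquiv
          (fun c' : PBond P (j + 1) => c'.src ∉ S.image PBond.src ∪ S.image PBond.tgt ∨ c'.tgt ∉ S.image PBond.src ∪ S.image PBond.tgt) (P := P) (G := G)) := by
    rw [Measure.map_smul, hsplit, ← Measure.prod_smul_left, ← hnear]
    calc _ = μρ.map (fun U : GaugeField P j G => FibreSplit.splitEquiv _ (P := P) (G := G) (fun c => if c ∈ S then avgFun ℰ U c else axialAvg U c)) :=
          Measure.map_map (FibreSplit.splitEquiv _ (P := P) (G := G)).measurable hHm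
      _ = _ := hprod
  have hmass : μρ Set.univ = ENNReal.ofReal (∫ U, ρ' U ∂(fieldMeasure P j G)) := by
    rw [hμρ, withDensity_apply _ MeasurableSet.univ, Measure.restrict_univ, ofReal_integral_eq_lintegral_ofReal hρ' (Filter.Eventually.of_forall hρ'0)]
  calc μρ.map (fun U : GaugeField P j G => (fun c => if c ∈ S then avgFun ℰ U c else axialAvg U c : GaugeField P (j + 1) G))
      = ((μρ.map (fun U : GaugeField P j G => (fun c => if c ∈ S then avgFun ℰ U c else axialAvg U c : GaugeField P (j + 1) G))).map
          (FibreSplit.splitEquiv _ (P := P) (G := G))).map (FibreSplit.splitEquiv _ (P := P) (G := G)).symm := (MeasurableEquiv.map_symm_map _).symm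
    _ = ((μρ Set.univ • fieldMeasure P (j + 1) G).map (FibreSplit.splitEquiv _ (P := P) (G := G))).map (FibreSplit.splitEquiv _ (P := P) (G := G)).symm := by rw [himage]
    _ = μρ Set.univ • fieldMeasure P (j + 1) G := MeasurableEquiv.map_symm_map _
    _ = _ := by rw [hmass]

/-- ★★ **`ρ ≡ 1`: THE GUARDED PART OF PRINT'S REFERENCE MEASURE ON AN ACYCLIC POLYMER IS INVISIBLE AFTER ONE STEP** — `(dU↾G_S)∘(Ū^S)⁻¹ = dU(G_S) • dV` whenever the near set of
`S` admits a leaf-extension order. [cite: Balaban1987RG1, (2.1) p.265 + (0.4) p.253; Balaban1985Averaging, (11)+(15) p.19 (bookkeeping — NOT in print)] -/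
theorem map_restrict_guard_hybrid_eq_smul_of_forest (hj : j + 1 ≤ P.m + P.K) (hE : ∀ n, Measurable fun W : Fin (n + 1) → G => ℰ.E W) (S : Finset (PBond P (j + 1)))
    {n : ℕ} (b : Fin n → PBond P (j + 1)) (hbinj : Function.Injective b)
    (hbnear : ∀ m, (b m).src ∈ S.image PBond.src ∪ S.image PBond.tgt ∧ (b m).tgt ∈ S.image PBond.src ∪ S.image PBond.tgt)
    (hbonto : ∀ c' : PBond P (j + 1), c'.src ∈ S.image PBond.src ∪ S.image PBond.tgt ∧ c'.tgt ∈ S.image PBond.src ∪ S.image PBond.tgt → ∃ m, b m = c')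
    (side : Fin n → Bool)
    (hleaf : ∀ m m' : Fin n, m' < m →
      (if side m then (b m).src else (b m).tgt) ≠ (b m').src ∧ (if side m then (b m).src else (b m).tgt) ≠ (b m').tgt) :
    ((fieldMeasure P j G).restrict {W : GaugeField P j G | ∀ c ∈ S, Small ℰ W c}).map
        (fun U => (fun c => if c ∈ S then avgFun ℰ U c else axialAvg U c : GaugeField P (j + 1) G)) =
      fieldMeasure P j G {W : GaugeField P j G | ∀ c ∈ S, Small ℰ W c} • fieldMeasure P (j + 1) G := by
  have hG := measurableSet_guardAll ℰ (P := P) (j := j) (G := G) S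
  have h := map_withDensity_guard_hybrid_eq_smul_of_forest ℰ hj hE S b hbinj hbnear hbonto side hleaf (fun _ => (1 : ℝ)) measurable_const (fun _ => zero_le_one)
    (integrable_const 1) (fun _ _ => rfl) (fun _ _ _ => rfl)
  have hfun : (fun U : GaugeField P j G => ENNReal.ofReal ((1 : ℝ) * {W : GaugeField P j G | ∀ c ∈ S, Small ℰ W c}.indicator (fun _ => (1 : ℝ)) U)) =
      {W : GaugeField P j G | ∀ c ∈ S, Small ℰ W c}.indicator (1 : GaugeField P j G → ℝ≥0∞) := by
    funext U
    by_cases hU : U ∈ {W : GaugeField P j G | ∀ c ∈ S, Small ℰ W c}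
    · rw [Set.indicator_of_mem hU, Set.indicator_of_mem hU, one_mul, ENNReal.ofReal_one, Pi.one_apply]
    · rw [Set.indicator_of_notMem hU, Set.indicator_of_notMem hU, mul_zero, ENNReal.ofReal_zero]
  have hdens : ((fieldMeasure P j G).withDensity fun U => ENNReal.ofReal ((1 : ℝ) * {W : GaugeField P j G | ∀ c ∈ S, Small ℰ W c}.indicator (fun _ => (1 : ℝ)) U)) =
      (fieldMeasure P j G).restrict {W : GaugeField P j G | ∀ c ∈ S, Small ℰ W c} := by
    rw [hfun, withDensity_indicator_one hG]
  have hmass : ENNReal.ofReal (∫ U, (1 : ℝ) * {W : GaugeField P j G | ∀ c ∈ S, Small ℰ W c}.indicator (fun _ => (1 : ℝ)) U ∂(fieldMeasure P j G)) =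
      fieldMeasure P j G {W : GaugeField P j G | ∀ c ∈ S, Small ℰ W c} := by
    simp_rw [one_mul]
    rw [integral_indicator hG, setIntegral_const, smul_eq_mul, mul_one, measureReal_def, ENNReal.ofReal_toReal (measure_ne_top _ _)]
  rw [hdens, hmass] at h
  exact h

end ForestPolymer

/-! ## §3 At the [B10] slot's averaging `avOfPrint N S₀ j` on `SU(N)` -/

section Slot

open Literature.MathematicalPhysics.QuantumFieldTheory.Balaban1985CMP102.Setting (Scales)
open Literature.MathematicalPhysics.QuantumFieldTheory.Balaban1983to89.ExpMeanLog (expMeanLogSU measurable_expMeanLogSU_E)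
open Literature.MathematicalPhysics.QuantumFieldTheory.Balaban1983to89.Node00 (SU)

variable (N : ℕ) [NeZero N] {L : ℕ}

/-- ★★★ **AT THE SLOT: ACYCLIC POLYMERS OF PRINT'S GUARD ARE INVISIBLE AFTER ONE STEP** (print's exp-mean-log averaging on `SU(N)`, every `N`, standing range):
`(dU↾G_S)∘(Ū^S)⁻¹ = dU(G_S) • dV` whenever the near set of `S` admits a leaf-extension order. [cite: Balaban1985UV3, (2) p.256; Balaban1987RG1, (2.1) p.265 + (0.4) p.253 (bookkeeping)] -/
theorem map_restrict_guard_hybrid_avOfPrint_eq_smul_of_forest (S₀ : Scales L) {j : ℕ} (hj : j + 1 ≤ S₀.P.m + S₀.P.K) [DecidableEq (PBond S₀.P (j + 1))]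
    (S : Finset (PBond S₀.P (j + 1))) {n : ℕ} (b : Fin n → PBond S₀.P (j + 1)) (hbinj : Function.Injective b)
    (hbnear : ∀ m, (b m).src ∈ S.image PBond.src ∪ S.image PBond.tgt ∧ (b m).tgt ∈ S.image PBond.src ∪ S.image PBond.tgt)
    (hbonto : ∀ c' : PBond S₀.P (j + 1), c'.src ∈ S.image PBond.src ∪ S.image PBond.tgt ∧ c'.tgt ∈ S.image PBond.src ∪ S.image PBond.tgt → ∃ m, b m = c')
    (side : Fin n → Bool)
    (hleaf : ∀ m m' : Fin n, m' < m →
      (if side m then (b m).src else (b m).tgt) ≠ (b m').src ∧ (if side m then (b m).src else (b m).tgt) ≠ (b m').tgt) :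
    ((fieldMeasure S₀.P j (SU N)).restrict {W : GaugeField S₀.P j (SU N) | ∀ c ∈ S, Small (expMeanLogSU : LoopAverage (SU N)) W c}).map
        (fun U => (fun c => if c ∈ S then avgFun (expMeanLogSU : LoopAverage (SU N)) U c else axialAvg U c : GaugeField S₀.P (j + 1) (SU N))) =
      fieldMeasure S₀.P j (SU N) {W : GaugeField S₀.P j (SU N) | ∀ c ∈ S, Small (expMeanLogSU : LoopAverage (SU N)) W c} • fieldMeasure S₀.P (j + 1) (SU N) :=
  map_restrict_guard_hybrid_eq_smul_of_forest (expMeanLogSU : LoopAverage (SU N)) hj measurable_expMeanLogSU_E S b hbinj hbnear hbonto side hleaf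

end Slot

end Summit.QuantumFields.YangMills.BalabanUVNodes.N08HaarCompatibilityGuardHybridForestPolymer

end
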